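import Mathlib.FieldTheory.IsAlgClosed.AlgebraicClosure
import Literature.AlgebraicGeometry.Frobenioids.ModelFrobenioidDivision
import Literature.AlgebraicGeometry.Frobenioids.ModelFrobenioidBaseSection
import Literature.AlgebraicGeometry.Frobenioids.ModelFrobenioidPullbacks
import Literature.AlgebraicGeometry.Frobenioids.PadicFrobenioidIsFrobenioid
import Literature.AlgebraicGeometry.Frobenioids.PerfectionPrimes
import Literature.AnabelianGeometry.SemiGraphs.TemperedCurvesWitness
import Literature.AnabelianGeometry.EtaleTheta.TemperedFrobenioidToy
import Literature.AnabelianGeometry.EtaleTheta.BiKummerOfModelCanonical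
import Literature.AnabelianGeometry.EtaleTheta.Discharge.Sec3Thm37
import HarnessLib

/-!
# [EtTh] §4: the setting of Definition 4.1 is inhabited (consistency witness for `BiKummerSetting`)

S. Mochizuki, *The étale theta function and its Frobenioid-theoretic manifestations*, Publ. RIMS **45**
(2009) [MochizukiEtTh2009], §4 "General Bi-Kummer Theory", setting of Definition 4.1, PDF p.86
(printed p.312): "we fix a tempered Frobenioid `C` whose monoid type is `ℤ`, whose divisor monoid `Φ`
is perfect, … Also, we fix a Frobenius-trivial object `A_⊙ ∈ Ob(C)` such that `A_⊙^bs := Base(A_⊙)` is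
a Galois object."

The statements file `BiKummer.lean` (abc-iut-L2-t3) types this setting as the hypothesis structure
`BiKummerSetting X T D VD`; `BiKummerOfModel(Canonical).lean` (abc-iut-L2-t9) fill its birational
vocabulary from the model Frobenioid ([FrdI] Thm 5.2 (ii)) as `BiKummerSetting.mkOfModelCanonical`.
Every §4 discharge theorem of the cell (Prop 4.2 (i)–(iv), Prop 4.3, Thm 4.4 closers under
`Discharge/Sec4*.lean`) is universally quantified over `S : BiKummerSetting …` and consumes the
hypothesis packages `FractionPair` / `IsSaturated` / `BaseFrobeniusTypeData` / `NthRoot` of Def 4.1 and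
Prop 4.2 (iii).  CONSISTENCY WITNESS, TOY — joint satisfiability of the §4 hypothesis packages;
consistency ≠ faithfulness (abc-iut-L2-lead 02:26:58Z).  This WITNESS file (its `def`s are toy DATA;
no `Prop`-valued definition, no named fact, no instance) kernel-checks that the hypothesis structure is
JOINTLY SATISFIABLE — i.e. that those theorems are not vacuously true — by ONE inhabitant obtained
through `mkOfModelCanonical` itself, and then inhabits the four packages over it (second section):

* the degenerate PERFECT tempered Frobenioid `Toy.temperedFrobenioidQ` over the one-object base
  category — the variant of abc-iut-L2-t3's `Toy.temperedFrobenioid` (`TemperedFrobenioidToy.lean`,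
  `Φ = ℕ`, NOT perfect) with `Φ₀ = Φ^{ℝ-log} = Φ = ℚ_{≥0}` (one prime, all its rational multiples), so
  that "`Φ` is perfect" holds (REAL `IsPerfect`, via L1's `isPerfect_of_mulEquiv_nnrat`) while
  Def 3.6 (ii)(a) "`Φ^{bs-fld}` monoprime" stays REAL (`ℚ`-monoprime) and (b) "`F → (Φ^{bs-fld})^gp`
  nonzero" holds with `B₀ = B₀^Λ = ℤ`, `div(n) = n·𝔭`, monoid type `Λ = ℤ`;
* `A_⊙ := (∗, 0)`, Frobenius-trivial by L1's [FrdI] Thm 5.2 proof step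
  `ModelFrobenioid.isFrobeniusTrivial_zeroObj` (REAL `PreFrobenioid.IsFrobeniusTrivial` in the model
  category of the tempered Frobenioid), `B` being group-like (`ratFnFunctor_isGroupLike`);
* `Π^tp_X ↠ G_K` := the vacuity-lane inhabitant `TemperedArithmeticGroup.nonempty_of_isAlgClosed`
  over `K := ℚ̄` (trivial group), `Π^tp_X ↠ Aut_D(A^bs)` the trivial homomorphism (surjective: the
  one-object discrete base has trivial automorphism groups), every base object Galois;
* the `(N, H)`-saturation slot (TODO-merge abc-iut-L1-t4, a free relation of `mkOfModelCanonical`)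
  := `True`.

HONEST LIMITS.  A consistency certificate for the TYPED interface stack
`DivisorMonoids → RealifiedDivisorMonoids → TemperedFrobenioid → BiKummerSetting` with the REAL
clauses (perfect `Φ`, monoprime `Φ^{bs-fld}`, nonzero `F → (Φ^{bs-fld})^gp`, group-saturation,
Frobenius-trivial `A_⊙`, surjective `Π ↠ Aut(A^bs)`) jointly satisfied; it is NOT the tempered
Frobenioid of a curve, the [FrdI] vocabulary predicates are the trivial ones of `Toy.monoidVocab` /
`Toy.catVocab`, and nothing is said about the free relation slot `IsNHSaturatedBsFld`.  No named
fact, no `sorry`.  Nothing here bears on, or takes a side on, [IUTchIII] Cor. 3.12.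
-/

noncomputable section

namespace Literature.AnabelianGeometry.EtaleTheta

open CategoryTheory Opposite Literature.AlgebraicGeometry.Frobenioids
open scoped NNRat

namespace Toy

/-! ## The perfect toy: `Φ₀ = Φ^{ℝ-log} = Φ = ℚ_{≥0}`, `B₀ = B₀^Λ = ℤ` -/

/-- The divisor of the "uniformiser" with rational multiplicities allowed downstream:
`ℤ → (ℚ_{≥0})^gp`, `n ↦ n·𝔭`. [cite: MochizukiEtTh2009, Def 3.3 p.73] -/
def divHomQ : Multiplicative ℤ →* Algebra.GrothendieckGroup (Multiplicative ℚ≥0) :=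
  zpowersHom _ (Algebra.GrothendieckGroup.of (Multiplicative.ofAdd 1))

/-- `divHomQ 1 = 𝔭`. [cite: MochizukiEtTh2009, Def 3.3 p.73] -/
theorem divHomQ_ofAdd_one :
    divHomQ (Multiplicative.ofAdd 1) = Algebra.GrothendieckGroup.of (Multiplicative.ofAdd 1) := by
  rw [divHomQ, zpowersHom_apply, toAdd_ofAdd, zpow_one]

/-- `gpMap id = id`, pointwise (transition maps of constant functors). [folklore] -/
private theorem gpMap_id_apply' {M : Type} [CommMonoid M] (x : Algebra.GrothendieckGroup M) :
    gpMap (MonoidHom.id M) x = x :=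
  DFunLike.congr_fun (Literature.AlgebraicGeometry.Frobenioids.gpMap_id (M := M)) x

/-- **Def 3.3 (iii) data, perfect degenerate inhabitant**: `Φ₀ = ℚ_{≥0}`, `B₀ = ℤ`,
`div₀ = (n ↦ n·𝔭)`, `F₀ = B₀`, everything non-cuspidal, over the one-object base category.
[cite: MochizukiEtTh2009, Def 3.3 p.73] -/
def divisorMonoidsQ : DivisorMonoids.{0, 0, 0} (Discrete PUnit.{1}) where
  Φ₀ := (Functor.const _).obj (CommMonCat.of (Multiplicative ℚ≥0))
  B₀ := (Functor.const _).obj (CommMonCat.of (Multiplicative ℤ))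
  isUnit_B₀ _ b := by
    change IsUnit (M := Multiplicative ℤ) b
    exact Group.isUnit _
  div₀ _ := divHomQ
  div₀_natural _ b := (gpMap_id_apply' (divHomQ b)).symm
  F₀ _ := ⊤
  F₀_map _ _ _ := trivial
  ncsp₀ _ := ⊤
  csp₀ _ := ⊥
  ncsp₀_map _ _ _ := trivial
  csp₀_map _ x hx := by
    rw [Submonoid.mem_bot] at hx ⊢
    rw [hx, map_one]
  existsUnique_ncsp_csp _ x := by
    refine ⟨(⟨x, trivial⟩, ⟨1, Submonoid.mem_bot.mpr rfl⟩), mul_one x, ?_⟩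
    rintro ⟨a, c⟩ h
    have hc : c.1 = 1 := Submonoid.mem_bot.mp c.2
    have ha : a.1 = x := by
      have h' : a.1 * c.1 = x := h
      rwa [hc, mul_one] at h'
    exact Prod.ext (Subtype.ext ha) (Subtype.ext hc)

/-- **Def 3.6 (i) data, perfect degenerate inhabitant** (`Λ = ℤ`, `Φ₀^ℝ = Φ₀ = ℚ_{≥0}`, `B₀^Λ = B₀ = ℤ`,
`ℝ·Φ₀^cnst =` all of `(Φ₀^ℝ)^gp`), over the trivial vocabulary. [cite: MochizukiEtTh2009, Def 3.6 p.76] -/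
def realifiedQ : RealifiedDivisorMonoids (D₀ := Discrete PUnit.{1}) monoidVocab where
  toDivisorMonoids := divisorMonoidsQ
  Λ := MonoidType.Z
  ΦR := (Functor.const _).obj (CommMonCat.of (Multiplicative ℚ≥0))
  toR _ := MonoidHom.id _
  toR_natural _ _ := rfl
  isRealification _ := trivial
  BΛ := (Functor.const _).obj (CommMonCat.of (Multiplicative ℤ))
  isUnit_BΛ _ b := by
    change IsUnit (M := Multiplicative ℤ) b
    exact Group.isUnit _
  divΛ _ := divHomQ
  divΛ_natural _ b := (gpMap_id_apply' (divHomQ b)).symm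
  FΛ _ := ⊤
  FΛ_map _ _ _ := trivial
  cnstR _ := ⊤
  cnstR_map _ _ _ := trivial
  divΛ_mem_cnstR _ _ _ := trivial
  cnstR_root _ _ _ _ := trivial
  cnst_le_cnstR _ _ _ := trivial
  ncspR _ := ⊤
  cspR _ := ⊥
  toR_ncsp _ _ _ := trivial
  toR_csp _ _ hx := hx

/-- A submonoid of `ℚ_{≥0}` which is everything is `ℚ`-monoprime (`Φ^{bs-fld}` of the perfect toy).
[cite: MochizukiEtTh2009, Def 3.6 p.77] -/
theorem isMonoprime_of_eq_top_nnrat {S : Submonoid (Multiplicative ℚ≥0)} (hS : S = ⊤) :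
    IsMonoprime ↥S := by
  subst hS
  exact IsMonoprime.ofQ ⟨⟨Submonoid.topEquiv⟩⟩

/-- **Def 3.6 (ii), perfect degenerate inhabitant**: the tempered-Frobenioid interface over the perfect
toy data with `D = D₀` the one-object category and `Φ = Φ^{ℝ-log} = ℚ_{≥0}`: group-saturated (trivially),
`Φ^{bs-fld} = ℚ_{≥0}` monoprime (REAL, `ℚ`-monoprime), and the constant `1 ∈ ℤ = F` has divisor `𝔭 ≠ 0`
(condition (b), REAL). [cite: MochizukiEtTh2009, Def 3.6 p.77] -/
def temperedFrobenioidQ : TemperedFrobenioid realifiedQ (Discrete PUnit.{1}) catVocab where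
  isConnected := zigzag_isConnected fun j₁ j₂ => by rw [Subsingleton.elim j₁ j₂]
  isTotallyEpimorphic := ⟨fun f => ⟨fun _ _ _ => Subsingleton.elim _ _⟩⟩
  base := 𝟭 _
  Φ := ⟨fun _ => ⊤, fun _ _ _ => trivial⟩
  isGroupSaturated A := (isGroupSaturated_iff' _).2 fun _ _ _ _ _ _ => trivial
  isPerfFactorial _ := trivial
  isDivisorialOn := trivial
  isMonoprime_bsFld A := isMonoprime_of_eq_top_nnrat
    (eq_top_iff.2 fun x _ => Submonoid.mem_inf.2 ⟨Submonoid.mem_top x,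
      (Subgroup.mem_top (Algebra.GrothendieckGroup.of x) :
        Algebra.GrothendieckGroup.of x ∈
          (⊤ : Subgroup (Algebra.GrothendieckGroup (Multiplicative ℚ≥0))))⟩)
  exists_FΛ_div_ne A := ⟨(Multiplicative.ofAdd (1 : ℤ) : Multiplicative ℤ), trivial,
    (Multiplicative.ofAdd (1 : ℚ≥0) : Multiplicative ℚ≥0), trivial, (1 : Multiplicative ℚ≥0), trivial,
    fun h => one_ne_zero (Multiplicative.ofAdd.injective h),
    divHomQ_ofAdd_one.trans (by
      change Algebra.GrothendieckGroup.of (M := Multiplicative ℚ≥0) (Multiplicative.ofAdd 1) =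
        Algebra.GrothendieckGroup.of (M := Multiplicative ℚ≥0) (Multiplicative.ofAdd 1) /
          Algebra.GrothendieckGroup.of (M := Multiplicative ℚ≥0) 1
      rw [(Algebra.GrothendieckGroup.of (M := Multiplicative ℚ≥0)).map_one, div_one])⟩

/-- "whose monoid type is `ℤ`" holds for the perfect toy. [cite: MochizukiEtTh2009, Def 4.1 p.86] -/
theorem temperedFrobenioidQ_monoidType : temperedFrobenioidQ.monoidType = MonoidType.Z := rfl

/-- "whose divisor monoid `Φ` is perfect" holds for the perfect toy: `Φ(A) = ℚ_{≥0}` and every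
`n`-th power map of `ℚ_{≥0}` (`n ≥ 1`) is bijective. [cite: MochizukiEtTh2009, Def 4.1 p.86] -/
theorem temperedFrobenioidQ_isPerfect (A : (Discrete PUnit.{1})ᵒᵖ) :
    IsPerfect (temperedFrobenioidQ.Φ.carrier A) :=
  isPerfect_of_mulEquiv_nnrat (N := ↥(⊤ : Submonoid (Multiplicative ℚ≥0))) Submonoid.topEquiv

/-- The interface stack Def 3.3 (iii) / 3.6 (i) / 3.6 (ii) has a PERFECT inhabitant of monoid type `ℤ`
(the two extra clauses of the §4 setting). [cite: MochizukiEtTh2009, Def 4.1 p.86] -/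
theorem nonempty_temperedFrobenioid_perfect :
    ∃ C : TemperedFrobenioid realifiedQ (Discrete PUnit.{1}) catVocab,
      C.monoidType = MonoidType.Z ∧ ∀ A, IsPerfect (C.Φ.carrier A) :=
  ⟨temperedFrobenioidQ, temperedFrobenioidQ_monoidType, temperedFrobenioidQ_isPerfect⟩

/-! ## The §4 setting over the perfect toy -/

/-- The base field of the toy setting: `K := ℚ̄` (so that `G_K` is trivial and the vacuity-lane
inhabitant of the tempered-`π₁` interface is available). [cite: MochizukiEtTh2009, Def 4.1 p.86] -/
abbrev Kbar : Type := AlgebraicClosure ℚ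

/-- `Π^tp_X ↠ G_K` of the toy setting: the degenerate inhabitant of the [SemiAnbd] Ex 3.10 interface
over `ℚ̄` (`TemperedArithmeticGroup.nonempty_of_isAlgClosed`). [cite: MochizukiEtTh2009, Def 4.1 p.86] -/
def temperedGroup : SemiGraphs.TemperedArithmeticGroup.{0} Kbar :=
  (SemiGraphs.TemperedArithmeticGroup.nonempty_of_isAlgClosed Kbar).some

/-- Automorphism groups in the one-object discrete base category are trivial. [folklore] -/
private theorem subsingleton_aut (A : Discrete PUnit.{1}) : Subsingleton (Aut A) :=
  ⟨fun _ _ => Iso.ext (Subsingleton.elim _ _)⟩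

/-- `A_⊙ := (∗, 0)`, the zero object of the model Frobenioid over the unique base object.
[cite: MochizukiEtTh2009, Def 4.1 p.86] -/
def Aodot : temperedFrobenioidQ.category :=
  ModelFrobenioid.zeroObj _ _ _ ⟨PUnit.unit⟩

/-- "a Frobenius-trivial object `A_⊙`": `(∗, 0)` is Frobenius-trivial in the model Frobenioid of the
perfect toy ([FrdI] Thm 5.2 proof, p.101, via L1's `ModelFrobenioid.isFrobeniusTrivial_zeroObj`; `B` is
group-like since `B₀^Λ` is). [cite: MochizukiEtTh2009, Def 4.1 p.86] -/
theorem isFrobeniusTrivial_Aodot :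
    PreFrobenioid.IsFrobeniusTrivial temperedFrobenioidQ.toElem Aodot :=
  ModelFrobenioid.isFrobeniusTrivial_zeroObj
    (temperedFrobenioidQ.ratFnFunctor_isGroupLike realifiedQ.isUnit_BΛ) _

/-- **The setting of [EtTh] §4 / Definition 4.1 is inhabited**: a `BiKummerSetting` over the perfect toy
tempered Frobenioid, built through abc-iut-L2-t9's canonical model constructor `mkOfModelCanonical`
(birational vocabulary, disjoint supports and base-Frobenius pairs FILLED from the model; Galois objects
:= all, `Π^tp_X ↠ Aut_D(A^bs)` := trivial, `(N,H)`-saturation slot := `True`, `A_⊙ := (∗, 0)`).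
[cite: MochizukiEtTh2009, Def 4.1 p.86] -/
def biKummerSetting :
    BiKummerSetting temperedGroup realifiedQ (Discrete PUnit.{1}) catVocab :=
  BiKummerSetting.mkOfModelCanonical temperedGroup temperedFrobenioidQ temperedFrobenioidQ_monoidType
    temperedFrobenioidQ_isPerfect (fun _ => True) (fun _ _ => 1)
    (fun A _ _ => ⟨1, (subsingleton_aut A).elim _ _⟩) (fun _ _ _ => True) Aodot
    isFrobeniusTrivial_Aodot trivial

/-- **Consistency witness for `BiKummerSetting`** (the hypothesis structure of every [EtTh] §4 discharge
theorem of the cell): the structure is inhabited, over the perfect toy tempered Frobenioid, through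
`mkOfModelCanonical`. [cite: MochizukiEtTh2009, Def 4.1 p.86] -/
theorem nonempty_biKummerSetting :
    Nonempty (BiKummerSetting temperedGroup realifiedQ (Discrete PUnit.{1}) catVocab) :=
  ⟨biKummerSetting⟩

/-! ## Definition 4.1 (i)–(iv) and the data of Proposition 4.2 (iii) are inhabited at the toy setting

Over `S := Toy.biKummerSetting` (the canonical model instance over the perfect toy), with `A_⊙ = (∗, 0)`,
`N = 1`, `f = 1 ∈ O^×(A_⊙^birat)`: the trivial fraction-pair `(id, id)` (Def 4.1 (i)), `A_⊙` is
`H_⊙`-ample and `(1, H_⊙, 1)`-saturated (Def 4.1 (ii)–(iii)), `id : A_⊙ → A_⊙` is of base-Frobenius type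
with `G = 1`, `α' = α'' = id` — condition (e) "arise from a base-Frobenius pair" being the REAL [FrdI]
Def 2.7 (iii) predicate at the model, witnessed by L1's zero section of the model Frobenioid
(`ModelFrobenioid.isBaseFrobeniusPair_zero`, proof of [FrdI] Thm 5.2, p.101) — and these assemble to a
`1`-st root of the trivial fraction-pair (the DATA structure `NthRoot` of Prop 4.2 (iii)) for the genuine
transport `pullFrac := pullFracModel`.  Hence the hypothesis packages `FractionPair`, `IsSaturated`,
`BaseFrobeniusTypeData`, `NthRoot` consumed by the §4 discharge theorems are jointly satisfiable with
`BiKummerSetting`. -/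

/-- `B` of the perfect toy is objectwise group-like (hypothesis `hBg` of L1's [FrdI] Thm 5.2 lemmas).
[cite: MochizukiEtTh2009, Def 3.6 p.77] -/
theorem ratFnFunctorQ_isGroupLike :
    Objectwise (fun M _ => IsGroupLike M) temperedFrobenioidQ.ratFnFunctor :=
  temperedFrobenioidQ.ratFnFunctor_isGroupLike realifiedQ.isUnit_BΛ

/-- `Φ = ℚ_{≥0}` of the perfect toy is objectwise divisorial (monoprime monoids are divisorial, L1's
`IsMonoprime.isDivisorial`; hypothesis `hΦd` of L1's [FrdI] Thm 5.2 lemmas).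
[cite: MochizukiEtTh2009, Def 3.6 p.77] -/
theorem divisorMonoidQ_isDivisorial :
    Objectwise (fun M _ => IsDivisorial M) temperedFrobenioidQ.divisorMonoid :=
  fun _ => (isMonoprime_of_eq_top_nnrat (S := (⊤ : Submonoid (Multiplicative ℚ≥0))) rfl).isDivisorial

/-- The one-object discrete base category is skeletal. [folklore] -/
private theorem skeletal_discretePUnit : Skeletal (Discrete PUnit.{1}) :=
  fun X Y _ => Discrete.ext (Subsingleton.elim X.as Y.as)

/-- **Def 4.1 (i) inhabited**: the trivial fraction-pair `(id, id) : A_⊙ → A_⊙` for `f = 1` — both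
pre-steps, base-equivalent, `id · id⁻¹ = 1`, and `Div(id) = 0`, `Div(id) = 0` have disjoint supports
(the only divisor of `0` in the sharp monoid `ℚ_{≥0}` is `0`). [cite: MochizukiEtTh2009, Def 4.1 p.86] -/
def fractionPairOne : biKummerSetting.FractionPair (A := Aodot) 1 Aodot where
  num := 𝟙 _
  den := 𝟙 _
  isPreStep_num := ModelFrobenioid.isPreStep_id _
  isPreStep_den := ModelFrobenioid.isPreStep_id _
  base_eq := rfl
  frac_eq := ModelFrobenioid.frac_self _ _
  disjointSupports x hx _ :=
    (divisorMonoidQ_isDivisorial (Discrete.mk PUnit.unit)).isSharp.eq_one_of_isUnit x (isUnit_of_dvd_one hx)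

/-- `A_⊙ = (∗, 0)` is Galois and `H_⊙`-ample (Def 4.1 (ii)): `Aut_D(A_⊙^bs)` is trivial.
[cite: MochizukiEtTh2009, Def 4.1 p.87] -/
theorem isAmple_Aodot : biKummerSetting.IsAmple Aodot :=
  ⟨trivial, fun _ _ => ⟨1, (subsingleton_aut _).elim _ _⟩⟩

/-- **Def 4.1 (iii) inhabited**: `A_⊙` is `(1, H_⊙, 1)`-saturated — `1` is fixed by `H_{A_⊙}`, (a) holds
with `A' = A'' = A_⊙` and the identity pre-steps (`A_⊙` Frobenius-trivial; the `(N, H^{bs-fld})`-slot of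
the toy is `True`), (b) `1 = 1^1`. [cite: MochizukiEtTh2009, Def 4.1 p.87] -/
theorem isSaturated_one : biKummerSetting.IsSaturated Aodot 1 1 where
  isAmple := isAmple_Aodot
  fixed σ _ := map_one (biKummerSetting.biratAut Aodot σ)
  cond_a := ⟨Aodot, Aodot, 𝟙 _, 𝟙 _, ModelFrobenioid.isPreStep_id _, ModelFrobenioid.isPreStep_id _,
    isFrobeniusTrivial_Aodot, trivial⟩
  cond_b := ⟨1, one_pow _⟩

/-- `A_⊙` is `μ_1`-saturated: `μ_1(A_⊙) = {1}` is generated by the element `1` of order `1`.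
[cite: MochizukiEtTh2009, Def 4.1 p.87] -/
theorem isMuSaturated_Aodot_one : biKummerSetting.IsMuSaturated Aodot 1 := by
  refine ⟨1, ⟨one_mem _, by rw [PNat.one_coe, pow_one]⟩, by rw [orderOf_one, PNat.one_coe], ?_⟩
  rintro τ ⟨-, hτ⟩
  rw [PNat.one_coe, pow_one] at hτ
  rw [hτ]
  exact one_mem _

/-- **Def 4.1 (iv)(e) at the model, inhabited**: `G = 1`, `α' = α'' = id_{A_⊙}` arise from the base-Frobenius
pair given by the ZERO SECTION of the model Frobenioid ([FrdI] Thm 5.2 proof, p.101; L1's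
`ModelFrobenioid.isBaseFrobeniusPair_zero` — `Φ` divisorial, `B` group-like, `D` skeletal).
[cite: MochizukiEtTh2009, Def 4.1 p.87] -/
theorem arisesFromBaseFrobeniusPair_one :
    temperedFrobenioidQ.ArisesFromBaseFrobeniusPair (A := Aodot) ⊥ (𝟙 Aodot) (𝟙 Aodot) := by
  refine ⟨ModelFrobenioid.zeroPresection _ _ _, ModelFrobenioid.zeroFrobeniusSection _ _ _,
    ModelFrobenioid.isBaseFrobeniusPair_zero divisorMonoidQ_isDivisorial ratFnFunctorQ_isGroupLike
      skeletal_discretePUnit, fun γ hγ => ?_, ⟨rfl, rfl, rfl, rfl, rfl⟩, ⟨rfl, 1, ?_⟩⟩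
  · rw [Subgroup.mem_bot] at hγ
    subst hγ
    exact ⟨rfl, rfl, rfl, rfl, rfl⟩
  · rw [map_one]
    rfl

/-- **Def 4.1 (iv) inhabited**: `id : A_⊙ → A_⊙` is of base-Frobenius type, with data `G = 1`,
`α' = α'' = id`: (a) `A_⊙` Frobenius-trivial, Galois, `μ_1`-saturated; (b) `1 ⥲ Gal(A_⊙^bs/A_⊙^bs) = 1`;
(c) `id` is a base-identity endomorphism of Frobenius type; (d) `id` is a pull-back morphism (L1's
`ModelFrobenioid.isPullbackMorphism_of`); (e) `arisesFromBaseFrobeniusPair_one`.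
[cite: MochizukiEtTh2009, Def 4.1 p.87] -/
def baseFrobeniusTypeDataId : biKummerSetting.BaseFrobeniusTypeData (𝟙 Aodot) where
  G := ⊥
  G_le := bot_le
  α₂ := 𝟙 _
  α₁ := 𝟙 _
  fac := Category.comp_id _
  isFrobeniusTrivial := isFrobeniusTrivial_Aodot
  isGalois := trivial
  isMuSaturated := isMuSaturated_Aodot_one
  mapsIsomorphically := by
    refine ⟨fun σ hσ => ?_, fun σ _ τ _ _ => ?_, fun τ _ => ⟨1, (⊥ : Subgroup (Aut Aodot)).one_mem, ?_⟩⟩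
    · have hσ' : σ = 1 := hσ
      subst hσ'
      rw [map_one]
      exact one_mem _
    · exact (show σ = 1 from ‹σ ∈ ((⊥ : Subgroup (Aut Aodot)) : Set (Aut Aodot))›).trans
        (show τ = 1 from ‹τ ∈ ((⊥ : Subgroup (Aut Aodot)) : Set (Aut Aodot))›).symm
    · exact (subsingleton_aut _).elim _ _
  cond_c := ⟨rfl, ⟨ModelFrobenioid.isCoAngular ratFnFunctorQ_isGroupLike _, rfl⟩,
    show IsIso (𝟙 (ModelFrobenioid.base Aodot)) from inferInstance⟩
  cond_d := ModelFrobenioid.isPullbackMorphism_of divisorMonoidQ_isDivisorial ratFnFunctorQ_isGroupLike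
    rfl rfl
  cond_e := arisesFromBaseFrobeniusPair_one

/-- Hence `id : A_⊙ → A_⊙` is of base-Frobenius type (Def 4.1 (iv)). [cite: MochizukiEtTh2009, Def 4.1 p.87] -/
theorem isOfBaseFrobeniusType_id : biKummerSetting.IsOfBaseFrobeniusType (𝟙 Aodot) :=
  ⟨baseFrobeniusTypeDataId⟩

/-- **The data of Prop 4.2 (iii) inhabited** at `N = 1`: the trivial fraction-pair is its own `1`-st root —
`A_1 = B_1 = A_⊙`, `α = β = id` (isometries of Frobenius degree `1`, `α` of base-Frobenius type via
`baseFrobeniusTypeDataId`), root `f_1 = 1` with `f_1^1 = (id^birat)^*(1)` for the genuine transport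
`pullFracModel`, and `A_⊙` `(1, H_⊙, f_1)`-saturated. [cite: MochizukiEtTh2009, Prop 4.2 p.88] -/
def nthRootOne :
    biKummerSetting.NthRoot (A := Aodot) 1 fractionPairOne 1
      (fun {A'} (φ : A' ⟶ Aodot) => temperedFrobenioidQ.pullFracModel φ) where
  AN := Aodot
  BN := Aodot
  α := 𝟙 _
  β := 𝟙 _
  root := 1
  pair := fractionPairOne
  comm_num := rfl
  comm_den := rfl
  isIsometry := ⟨ModelFrobenioid.isIsometry_id _, ModelFrobenioid.isIsometry_id _, rfl, rfl⟩
  αData := baseFrobeniusTypeDataId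
  pow_root := by rw [one_pow]; exact (map_one _).symm
  isSaturated := by
    show biKummerSetting.IsSaturated Aodot 1 (temperedFrobenioidQ.pullFracModel (𝟙 Aodot) 1)
    rw [map_one]
    exact isSaturated_one

/-- **Consistency witness for the §4 data stack**: over an inhabited `BiKummerSetting` (the perfect toy
through `mkOfModelCanonical`) there are `f ∈ O^×(A_⊙^birat)`, a fraction-pair for `f` (Def 4.1 (i)) and an
`N`-th root of it (Prop 4.2 (iii) data, `N = 1`; carrying Def 4.1 (ii)–(iv) incl. the REAL [FrdI]
Def 2.7 (iii) condition (e)) for the genuine transport `pullFracModel` — so the hypothesis structures of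
the cell's §4 discharge theorems are jointly satisfiable. [cite: MochizukiEtTh2009, Prop 4.2 p.88] -/
theorem nonempty_nthRoot :
    Nonempty (BiKummerSetting temperedGroup realifiedQ (Discrete PUnit.{1}) catVocab) ∧
      ∃ (B : biKummerSetting.C) (f : biKummerSetting.biratUnits biKummerSetting.Aodot)
        (P : biKummerSetting.FractionPair f B),
        Nonempty (biKummerSetting.NthRoot f P 1
          fun {A'} (φ : A' ⟶ biKummerSetting.Aodot) => temperedFrobenioidQ.pullFracModel φ) :=
  ⟨⟨biKummerSetting⟩, Aodot, 1, fractionPairOne, ⟨nthRootOne⟩⟩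

end Toy

end Literature.AnabelianGeometry.EtaleTheta

end
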